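/-
Copyright (c) 2026. Released under the Apache 2.0 license.
-/
import Literature.NumberTheory.EllipticCurves.ManinConstantGamma1ModularDegree
import Literature.NumberTheory.EllipticCurves.ManinConstantSemistablePrimewise
import Literature.NumberTheory.EllipticCurves.ManinConstantConductorLe300000
import Literature.NumberTheory.EllipticCurves.Isogeny
import Literature.NumberTheory.EllipticCurves.ModularCurveManinConstantProofs
import HarnessLib

/-!
# The `X₁(N)`-optimal Manin constant divides the `X₀(N)`-optimal one
# (Česnavičius–Neururer–Saha, JEMS 26 (2024), Lemma 6.5 = Česnavičius 2018, Lemma 2.12)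

The source. K. Česnavičius, M. Neururer, A. Saha, *The Manin constant and the modular degree*,
J. Eur. Math. Soc. 26 (2024), no. 2, 573–637 (bib key `CesnaviciusNeururerSaha2023`; authors'
final version, p. 42), **Lemma 6.5**, verbatim: "For `Γ₁(N) ⊂ Γ ⊂ Γ′ ⊂ Γ₀(N)`, the Jacobians `J_Γ`
and `J_Γ′` of `(X_Γ)_ℚ` and `(X_Γ′)_ℚ`, and isogenous newform elliptic curve quotients `π : J_Γ ↠ E`
and `π′ : J_Γ′ ↠ E′`, if `Ker(π)` and `Ker(π′)` are connected, then there is an isogeny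
`e : E → E′` such that the Manin constants `c_π` and `c_π′` satisfy
`c_π′ = c_π · #Coker(Lie 𝓔 → Lie 𝓔′)` where `𝓔` and `𝓔′` are the Néron models of `E` and `E′`.
Moreover, `c_π ∈ ℤ` for any newform elliptic curve quotient `π : J_Γ ↠ E` (regardless of
`Ker(π)`)." Its proof (p. 43): "Everything was settled in [Čes18, Lemma 2.12] except for the
assertion that `c_π ∈ ℤ` …" — K. Česnavičius, *The Manin constant in the semistable case*,
Compos. Math. 154 (2018) 1889–1920, Lemma 2.12 (held: `paper:arxiv-1703.02951`, chunk p0007):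
"`c_π′ = c_π · #(…)`", a positive integer factor attached to the isogeny `e`. The printed USE of the
lemma (ČNS §1, footnote 2, p. 2): "Manin considered `Γ = Γ₀(N)`, and this implies the general case
by Lemma 6.5. In [Ste89], Stevens … conjectured that `c_φ = ±1` for [minimal parametrizations by
`X₁(N)_ℚ`]"; and (Čes18, Prop. 2.13 = `manin-H-sst`, chunk p0007): "for … `Γ₁(n) ⊂ H ⊂ Γ₀(n)`, and a
new elliptic optimal quotient `π : J_H ↠ E`, if `p` is a prime with `p² ∤ n`, then … `ord_p(c_π) =
0`", proved there in two lines: "By [Thm. 1.2], `ord_p(c_π′) = 0`, so, since `c_π ∈ ℤ`, [Lemma 2.12]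
implies that `ord_p(c_π) = 0`."

## What is transcribed, and how

Only the case `Γ = Γ₁(N)`, `Γ′ = Γ₀(N)` has parametrisation vocabulary in the tree:
`Gamma1ParametrizationData W N` (`ManinConstantGamma1ModularDegree.lean`: the `X₁(N)`-datum with its
Manin constant `c ∈ ℤ`, `c Λ₁(f) ⊆ Λ_E`) and `ModularParametrizationData W N` (the `X₀(N)`-datum,
`c Λ_f ⊆ Λ_E`). "`Ker(π′)` connected" (`π′ : J₀(N) ↠ E′` is the OPTIMAL quotient) is the tree's
lattice clause `Λ_{E′} = c′ Λ_f` — `∀ z ∈ D₀.L.lattice, ∃ w ∈ periodLattice D₀.f, z = D₀.c * w` — used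
verbatim by every `X₀(N)`-optimality statement of the tree (`IsOptimalModel`,
`mazur_not_dvd_maninConstant_of_odd`, `cremona_abs_maninConstant_eq_one_of_level_le_500000`, …:
`H₁(X₀(N), ℤ) → H₁(E′, ℤ) = Λ_{E′}` is onto iff `Ker(π′)` is connected); its `Γ₁(N)` twin
"`Ker(π)` connected" is the clause `Λ_E = c Λ₁(f)` with the `Γ₁(N)`-period lattice
`periodLatticeGamma1 f` (periods of `ω_f` over `H₁(X₁(N), ℤ)`), named here
`Gamma1ParametrizationData.IsOptimal` (a definition; Stevens 1989, §2: the `X₁(N)`-optimal curve is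
`ℂ/Λ₁(f)` rescaled). The conclusion is transcribed as its ARITHMETIC CONSEQUENCE
`c_π ∣ c_π′` (`#Coker(…)` is a positive integer) — WEAKER than print (the cokernel identity and the
intermediate levels `Γ`, `Γ′` are not transcribed: no Néron models in the tree; `TODO(general
form)`), as the named fact `cesnaviciusNeururerSaha_lemma_6_5_dvd`. The "Moreover, `c_π ∈ ℤ`" is
built into both data (`c : ℤ`).

PROVED from the fact (the printed uses): Manin's conjecture for a class implies Stevens' for it
(`abs_maninConstant₁_eq_one_of_abs_maninConstant₀_eq_one`, footnote 2); `ord_p(c₁) ≤ ord_p(c₀)`;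
Česnavičius 2018 Prop. 2.13 at `H = Γ₁(n)` from the tree's `Γ₀(n)` assembly
`cesnavicius2018_not_dvd_maninConstant_of_not_sq_dvd_level` (`p² ∤ N ⟹ p ∤ c₁`), exactly as printed;
and `|c₁| = 1` whenever `N ≤ 500000` from Cremona's verification as cited by ČNS
(`cremona_abs_maninConstant_eq_one_of_level_le_500000`). In all of these the `X₀(N)`-optimal datum
`D₀` of an isogenous curve is an explicit hypothesis (in print it exists by modularity: "Let
`π′ : J₀(n) ↠ E′` be the new elliptic optimal quotient for which `E′` is isogenous to `E`").

## References
* [CesnaviciusNeururerSaha2023] op. cit., Lemma 6.5 (p. 42) and its proof (p. 43); §1 fn. 2 (p. 2).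
* [Cesnavicius2018] K. Česnavičius, *The Manin constant in the semistable case*, Compos. Math. 154
  (2018), Lemma 2.12 and Prop. 2.13 (arXiv:1703.02951, §2).
* [Stevens1989] G. Stevens, *Stickelberger elements and modular parametrizations of elliptic
  curves*, Invent. Math. 98 (1989), §2 and Thm. 1.6 (`c_π ∈ ℤ` for `X₁(N)`).
-/

noncomputable section

open scoped MatrixGroups ModularForm

open CongruenceSubgroup UpperHalfPlane WeierstrassCurve

namespace Literature.NumberTheory.EllipticCurves.ModularForms

/-! ### `X₁(N)`-optimality of a `Γ₁(N)`-parametrisation datum -/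

namespace Gamma1ParametrizationData

variable {W : WeierstrassCurve ℚ} {N : ℕ} [NeZero N]

/-- **"`Ker(π)` is connected" for `π : J₁(N) ↠ E`, i.e. `φ_D : X₁(N) → E` is the OPTIMAL
`X₁(N)`-parametrisation (`E` is Stevens' `X₁(N)`-optimal curve of its class)**: the lattice clause
`Λ_E ⊆ c · Λ₁(f)` (hence `Λ_E = c · Λ₁(f)`, `IsOptimal.mem_lattice_iff`, the inclusion `⊇` being the
datum's `smul_periodLatticeGamma1_le`) — the `Γ₁(N)` twin of the tree's `X₀(N)`-optimality clause
`∀ z ∈ D₀.L.lattice, ∃ w ∈ periodLattice D₀.f, z = D₀.c * w` (`IsOptimalModel`): the push-forward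
`H₁(X₁(N), ℤ) → H₁(E, ℤ) = Λ_E`, `γ ↦ c ∫_γ ω_f`, has image `c Λ₁(f)`, and it is onto iff `Ker(π)` is
connected (ČNS Lemma 6.5's hypothesis; Stevens 1989, §2). A predicate; nothing asserted.
[cite: CesnaviciusNeururerSaha2023, Lemma 6.5 (p. 42)] -/
def IsOptimal (D : Gamma1ParametrizationData W N) : Prop :=
  ∀ z ∈ D.L.lattice, ∃ w ∈ periodLatticeGamma1 D.f, z = D.c * w

variable {D : Gamma1ParametrizationData W N}

/-- Under optimality the Néron lattice IS `c · Λ₁(f)`: `z ∈ Λ_E ↔ z = c w` for some `w ∈ Λ₁(f)`.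
[cite: CesnaviciusNeururerSaha2023, Lemma 6.5 (p. 42)] -/
theorem IsOptimal.mem_lattice_iff (h : D.IsOptimal) (z : ℂ) :
    z ∈ D.L.lattice ↔ ∃ w ∈ periodLatticeGamma1 D.f, z = D.c * w :=
  ⟨h z, by rintro ⟨w, hw, rfl⟩; exact D.smul_periodLatticeGamma1_le w hw⟩

end Gamma1ParametrizationData

/-! ### Lemma 6.5 (`Γ = Γ₁(N)`, `Γ′ = Γ₀(N)`): `c_π ∣ c_π′` — named fact -/

/-- **Česnavičius–Neururer–Saha 2024, Lemma 6.5 (= Česnavičius 2018, Lemma 2.12), divisibility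
consequence at `Γ = Γ₁(N) ⊂ Γ′ = Γ₀(N)`.** Printed (JEMS 26 (2024), Lemma 6.5, p. 42), verbatim:
"For `Γ₁(N) ⊂ Γ ⊂ Γ′ ⊂ Γ₀(N)` … and isogenous newform elliptic curve quotients `π : J_Γ ↠ E` and
`π′ : J_Γ′ ↠ E′`, if `Ker(π)` and `Ker(π′)` are connected, then there is an isogeny `e : E → E′`
such that the Manin constants `c_π` and `c_π′` satisfy `c_π′ = c_π · #Coker(Lie 𝓔 → Lie 𝓔′)` …
Moreover, `c_π ∈ ℤ`". Rendering (module docstring): for globally minimal models `W₁`, `W₀` of two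
`ℚ`-isogenous elliptic curves, a level `N ≥ 1`, an OPTIMAL `X₁(N)`-datum `D₁` of `W₁`
(`D₁.IsOptimal`: `Λ_{E₁} = c₁ Λ₁(f)`, "`Ker(π)` connected") and an OPTIMAL `X₀(N)`-datum `D₀` of `W₀`
(`Λ_{E₀} = c₀ Λ_f`, "`Ker(π′)` connected"): `c₁ ∣ c₀` (`#Coker(…) ∈ ℤ_{>0}`; signs are immaterial
for divisibility). WEAKER than print (cokernel identity, intermediate `Γ, Γ′` not transcribed —
`TODO(general form)`: Néron models). Named fact (statement only).
[cite: CesnaviciusNeururerSaha2023, Lemma 6.5 (p. 42)] [cite: Cesnavicius2018, Lemma 2.12] -/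
def cesnaviciusNeururerSaha_lemma_6_5_dvd : Prop :=
  ∀ (W₁ W₀ : WeierstrassCurve ℚ) [W₁.IsElliptic] [W₁.IsGloballyMinimal] [W₀.IsElliptic]
    [W₀.IsGloballyMinimal] {N : ℕ} [NeZero N] (D₁ : Gamma1ParametrizationData W₁ N)
    (D₀ : ModularParametrizationData W₀ N), IsIsogenous W₁ W₀ → D₁.IsOptimal →
    (∀ z ∈ D₀.L.lattice, ∃ w ∈ periodLattice D₀.f, z = D₀.c * w) →
    D₁.maninConstant ∣ D₀.maninConstant

-- TODO(general form): the identity `c_π′ = c_π · #Coker(Lie 𝓔 → Lie 𝓔′)` for the isogeny `e`, and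
-- intermediate levels `Γ₁(N) ⊂ Γ ⊂ Γ′ ⊂ Γ₀(N)` (no Néron models / `X_Γ` for general `Γ` in tree).

/-! ### The printed uses (proved from the fact) -/

section Consequences

variable {W₁ W₀ : WeierstrassCurve ℚ} [W₁.IsElliptic] [W₁.IsGloballyMinimal] [W₀.IsElliptic]
  [W₀.IsGloballyMinimal] {N : ℕ} [NeZero N]

/-- `ord_p(c₁) ≤ ord_p(c₀)` at every prime (`c₁ ∣ c₀`, and `c₀ ≠ 0` by the tree's
`ModularParametrizationData.maninConstant_ne_zero_holds`).
[cite: CesnaviciusNeururerSaha2023, Lemma 6.5 (p. 42)] -/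
theorem padicValInt_maninConstant₁_le_maninConstant₀ (h65 : cesnaviciusNeururerSaha_lemma_6_5_dvd)
    (D₁ : Gamma1ParametrizationData W₁ N) (D₀ : ModularParametrizationData W₀ N)
    (hiso : IsIsogenous W₁ W₀) (h₁ : D₁.IsOptimal)
    (h₀ : ∀ z ∈ D₀.L.lattice, ∃ w ∈ periodLattice D₀.f, z = D₀.c * w) (p : ℕ) [hp : Fact p.Prime] :
    padicValInt p D₁.maninConstant ≤ padicValInt p D₀.maninConstant := by
  have hdvd : D₁.maninConstant.natAbs ∣ D₀.maninConstant.natAbs :=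
    Int.natAbs_dvd_natAbs.mpr (h65 W₁ W₀ D₁ D₀ hiso h₁ h₀)
  have h0 : D₀.maninConstant.natAbs ≠ 0 := Int.natAbs_ne_zero.mpr D₀.maninConstant_ne_zero_holds
  rw [padicValInt, padicValInt, ← padicValNat_dvd_iff_le h0]
  exact pow_padicValNat_dvd.trans hdvd

/-- **A prime not dividing the `X₀(N)`-optimal constant does not divide the `X₁(N)`-optimal one**
(the shape of Česnavičius 2018's proof of Prop. 2.13: "`ord_p(c_π′) = 0`, so, since `c_π ∈ ℤ`,
[Lemma 2.12] implies that `ord_p(c_π) = 0`"). [cite: Cesnavicius2018, Prop. 2.13 (proof)]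
[cite: CesnaviciusNeururerSaha2023, Lemma 6.5 (p. 42)] -/
theorem not_dvd_maninConstant₁_of_not_dvd_maninConstant₀ (h65 : cesnaviciusNeururerSaha_lemma_6_5_dvd)
    (D₁ : Gamma1ParametrizationData W₁ N) (D₀ : ModularParametrizationData W₀ N)
    (hiso : IsIsogenous W₁ W₀) (h₁ : D₁.IsOptimal)
    (h₀ : ∀ z ∈ D₀.L.lattice, ∃ w ∈ periodLattice D₀.f, z = D₀.c * w) {p : ℕ}
    (hp : ¬ (p : ℤ) ∣ D₀.maninConstant) : ¬ (p : ℤ) ∣ D₁.maninConstant :=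
  fun h ↦ hp (h.trans (h65 W₁ W₀ D₁ D₀ hiso h₁ h₀))

/-- **Manin's conjecture for the class implies Stevens' conjecture for it** (ČNS §1 fn. 2: "Manin
considered `Γ = Γ₀(N)`, and this implies the general case by Lemma 6.5"): if the `X₀(N)`-optimal
constant is `±1`, so is the `X₁(N)`-optimal one.
[cite: CesnaviciusNeururerSaha2023, §1 fn. 2 (p. 2) with Lemma 6.5 (p. 42)] -/
theorem abs_maninConstant₁_eq_one_of_abs_maninConstant₀_eq_one (h65 : cesnaviciusNeururerSaha_lemma_6_5_dvd)
    (D₁ : Gamma1ParametrizationData W₁ N) (D₀ : ModularParametrizationData W₀ N)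
    (hiso : IsIsogenous W₁ W₀) (h₁ : D₁.IsOptimal)
    (h₀ : ∀ z ∈ D₀.L.lattice, ∃ w ∈ periodLattice D₀.f, z = D₀.c * w)
    (hc₀ : |D₀.maninConstant| = 1) : |D₁.maninConstant| = 1 := by
  have hdvd := h65 W₁ W₀ D₁ D₀ hiso h₁ h₀
  rw [Int.abs_eq_natAbs, Nat.cast_eq_one] at hc₀ ⊢
  exact Nat.dvd_one.mp (hc₀ ▸ Int.natAbs_dvd_natAbs.mpr hdvd)

/-- **Česnavičius 2018, Prop. 2.13 at `H = Γ₁(n)`** ("for … `Γ₁(n) ⊂ H ⊂ Γ₀(n)`, and a new elliptic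
optimal quotient `π : J_H ↠ E`, if `p` is a prime with `p² ∤ n`, then … `ord_p(c_π) = 0`"), DERIVED
as printed from the `Γ₀(n)` case — the tree's assembly
`cesnavicius2018_not_dvd_maninConstant_of_not_sq_dvd_level` of Mazur's Cor. 4.1, Abbes–Ullmo's
Thm. A and Česnavičius's Thm. 1.2 (its three named-fact children `hM`, `hAU`, `hC`) — and
Lemma 6.5 / 2.12: for the optimal `X₁(N)`-datum `D₁` (with an optimal `X₀(N)`-datum `D₀` of an
isogenous curve) and a prime `p` with `p² ∤ N`, `p ∤ c₁`.
[cite: Cesnavicius2018, Prop. 2.13] [cite: CesnaviciusNeururerSaha2023, Lemma 6.5 (p. 42)] -/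
theorem cesnavicius2018_not_dvd_maninConstant₁_of_not_sq_dvd_level (h65 : cesnaviciusNeururerSaha_lemma_6_5_dvd)
    (D₁ : Gamma1ParametrizationData W₁ N) (D₀ : ModularParametrizationData W₀ N)
    (hiso : IsIsogenous W₁ W₀) (h₁ : D₁.IsOptimal)
    (h₀ : ∀ z ∈ D₀.L.lattice, ∃ w ∈ periodLattice D₀.f, z = D₀.c * w)
    (hM : mazur_not_dvd_maninConstant_of_odd)
    (hAU : abbesUllmo_not_dvd_maninConstant_of_not_dvd_level)
    (hC : cesnavicius_not_two_dvd_maninConstant_of_two_dvd_level) {p : ℕ} (hp : p.Prime)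
    (hp2 : ¬ p ^ 2 ∣ N) : ¬ (p : ℤ) ∣ D₁.maninConstant :=
  not_dvd_maninConstant₁_of_not_dvd_maninConstant₀ h65 D₁ D₀ hiso h₁ h₀
    (cesnavicius2018_not_dvd_maninConstant_of_not_sq_dvd_level hM hAU hC W₀ D₀ h₀ hp hp2)

/-- Valuation form of the previous theorem: `ord_p(c₁) = 0` for `p² ∤ N`.
[cite: Cesnavicius2018, Prop. 2.13] -/
theorem cesnavicius2018_padicValInt_maninConstant₁_eq_zero_of_not_sq_dvd_level (h65 : cesnaviciusNeururerSaha_lemma_6_5_dvd)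
    (D₁ : Gamma1ParametrizationData W₁ N) (D₀ : ModularParametrizationData W₀ N)
    (hiso : IsIsogenous W₁ W₀) (h₁ : D₁.IsOptimal)
    (h₀ : ∀ z ∈ D₀.L.lattice, ∃ w ∈ periodLattice D₀.f, z = D₀.c * w)
    (hM : mazur_not_dvd_maninConstant_of_odd)
    (hAU : abbesUllmo_not_dvd_maninConstant_of_not_dvd_level)
    (hC : cesnavicius_not_two_dvd_maninConstant_of_two_dvd_level) (p : ℕ) [hp : Fact p.Prime]
    (hp2 : ¬ p ^ 2 ∣ N) : padicValInt p D₁.maninConstant = 0 :=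
  padicValInt.eq_zero_of_not_dvd
    (cesnavicius2018_not_dvd_maninConstant₁_of_not_sq_dvd_level h65 D₁ D₀ hiso h₁ h₀ hM hAU hC
      hp.out hp2)

/-- **Stevens' `c_φ = ±1` at levels `N ≤ 500000`, modulo the two named facts**: Cremona's
verification of the Manin conjecture for `N ≤ 500000` as cited by ČNS §1 p. 2 (tree fact
`cremona_abs_maninConstant_eq_one_of_level_le_500000`: `|c₀| = 1` for optimal `X₀(N)`-data at
levels `≤ 500000`) and Lemma 6.5 give `|c₁| = 1` for the optimal `X₁(N)`-datum of any curve
isogenous to such an `X₀(N)`-optimal one (fn. 2: "this implies the general case by Lemma 6.5").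
[cite: CesnaviciusNeururerSaha2023, §1 p. 2 and fn. 2, Lemma 6.5 (p. 42)] -/
theorem abs_maninConstant₁_eq_one_of_level_le_500000 (h65 : cesnaviciusNeururerSaha_lemma_6_5_dvd)
    (D₁ : Gamma1ParametrizationData W₁ N) (D₀ : ModularParametrizationData W₀ N)
    (hiso : IsIsogenous W₁ W₀) (h₁ : D₁.IsOptimal)
    (h₀ : ∀ z ∈ D₀.L.lattice, ∃ w ∈ periodLattice D₀.f, z = D₀.c * w)
    (hCre : cremona_abs_maninConstant_eq_one_of_level_le_500000) (hN : N ≤ 500000) :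
    |D₁.maninConstant| = 1 :=
  abs_maninConstant₁_eq_one_of_abs_maninConstant₀_eq_one h65 D₁ D₀ hiso h₁ h₀ (hCre W₀ D₀ h₀ hN)

end Consequences

/-! ### Existence of the `X₁(N)`-optimal datum in the class of an `X₀(N)`-optimal curve — named fact

(cell `bsd-f2-manin`, an g16 MEMO-an §58 support row `ExistsOptimalGamma1Datum`, refuter-1 §R55: «an F-need
(Stevens 1989: some curve in the class is `X₁`-optimal with connected kernel) — statement-only when filed,
hypotheses = a lattice-optimal `X₀`-datum (satisfiable: every optimal class)»; this is the hypothesis under which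
the consequences above become unconditional in `D₁`.) -/

/-- **Existence of the `X₁(N)`-optimal curve and datum** (Conrad–Edixhoven–Stein 2003, §6.1: for a newform `f`
the OPTIMAL quotient `A_f = J₁(N)/I_f J₁(N)` of `J₁(N)` (p. 380), whose Manin index `c ∈ ℚ` (Def. 6.1.4) is an
INTEGER (Lemma 6.1.6, p. 381; for `J₀(N)` «the usual Manin constant equals the Manin index», Rem. 6.1.5);
Stevens 1989, §2: the `X₁(N)`-optimal («strong `X₁(N)`-Weil») curve of an isogeny class and its parametrisation
with connected kernel).  Rendering in the tree's vocabulary: for a globally minimal elliptic `W₀` with an OPTIMAL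
`X₀(N)`-datum `D₀` (`Λ_{E₀} = c₀ Λ_f`, "`Ker(π′)` connected"), there is a globally minimal elliptic `W₁`,
`ℚ`-isogenous to `W₀`, carrying an OPTIMAL `X₁(N)`-datum `D₁` (`Gamma1ParametrizationData`,
`D₁.IsOptimal`: `Λ_{E₁} = c₁ Λ₁(f)`, "`Ker(π)` connected", `c₁ ∈ ℤ` built into the datum) — the optimal
quotient of `J₁(N)` attached to the newform `D₀.f`, which lies in the isogeny class of `W₀` (same newform), on a
global minimal model.  The `X₀`-optimality hypothesis on `D₀` is not needed for the existence and only fixes the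
class; it is kept because every consumer (`cesnaviciusNeururerSaha_lemma_6_5_dvd` and its consequences above, the
cell's Γ₀/Γ₁ ledger E-an-66/67) carries it.  Named fact (statement only).
[cite: ConradEdixhovenStein2003, §6.1, Def. 6.1.4, Rem. 6.1.5 and Lemma 6.1.6 (pp. 380–381)] [cite: Stevens1989, §2] -/
def exists_optimal_gamma1ParametrizationData : Prop :=
  ∀ (W₀ : WeierstrassCurve ℚ) [W₀.IsElliptic] [W₀.IsGloballyMinimal] {N : ℕ} [NeZero N]
    (D₀ : ModularParametrizationData W₀ N),
    (∀ z ∈ D₀.L.lattice, ∃ w ∈ periodLattice D₀.f, z = D₀.c * w) →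
    ∃ (W₁ : WeierstrassCurve ℚ) (_ : W₁.IsElliptic) (_ : W₁.IsGloballyMinimal)
      (D₁ : Gamma1ParametrizationData W₁ N), IsIsogenous W₁ W₀ ∧ D₁.IsOptimal

section ExistenceConsequences

variable {W₀ : WeierstrassCurve ℚ} [W₀.IsElliptic] [W₀.IsGloballyMinimal] {N : ℕ} [NeZero N]

/-- With the existence fact, ČNS Lemma 6.5 yields UNCONDITIONALLY in `D₁`: every `X₀(N)`-optimal class carries an
`X₁(N)`-optimal datum whose Manin constant divides the `X₀(N)`-one (`c₁ ∣ c₀`).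
[cite: CesnaviciusNeururerSaha2023, Lemma 6.5 (p. 42)] [cite: ConradEdixhovenStein2003, §6.1 Lemma 6.1.6 (p. 381)] -/
theorem exists_gamma1_maninConstant_dvd (hex : exists_optimal_gamma1ParametrizationData)
    (h65 : cesnaviciusNeururerSaha_lemma_6_5_dvd) (D₀ : ModularParametrizationData W₀ N)
    (h₀ : ∀ z ∈ D₀.L.lattice, ∃ w ∈ periodLattice D₀.f, z = D₀.c * w) :
    ∃ (W₁ : WeierstrassCurve ℚ) (_ : W₁.IsElliptic) (_ : W₁.IsGloballyMinimal)
      (D₁ : Gamma1ParametrizationData W₁ N), IsIsogenous W₁ W₀ ∧ D₁.IsOptimal ∧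
        D₁.maninConstant ∣ D₀.maninConstant := by
  obtain ⟨W₁, i₁, i₂, D₁, hiso, hopt⟩ := hex W₀ D₀ h₀
  exact ⟨W₁, i₁, i₂, D₁, hiso, hopt, h65 W₁ W₀ D₁ D₀ hiso hopt h₀⟩

end ExistenceConsequences

end Literature.NumberTheory.EllipticCurves.ModularForms

end
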